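import Summits.KontsevichZagierPeriods.KontsevichZagierPeriods.Theorems.AbelContractionRealHyperellipticSectorDefs
import Summits.KontsevichZagierPeriods.KontsevichZagierPeriods.Theorems.AbelContractionRealHyperellipticSectorBudgetKit
import Summits.KontsevichZagierPeriods.KontsevichZagierPeriods.Theorems.AbelContractionGenusOneOneMove

/-!
# Route AbelContraction — `RealHyperellipticSector` (crux stmt-KontsevichZagierPeriods-12475): the engine in genus one

Helper file of the line `Lines/birth.lean` (registered sub-goal `cauchyRel_genus_one` of the stub
`stub_engine`, `--supports` the crux). **The genus-one rung of the contraction engine**: for an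
M-quartic `q ∈ ℚ[X]` (`deg q = 4`, four simple real roots `e 0 < e 1 < e 2 < e 3`, so that
`q = lc · ∏ᵢ (x − e i)` over `ℝ`) and a constant `P` (`deg P < 1`), the real Cauchy relator
`[O₀, P/√q] − [O₁, P/√q]` of the two ovals `O₀ = (e 0, e 1)`, `O₁ = (e 2, e 3)` lies in the
truncated relations `KZ.relationsLE 1`: it is (minus) ONE change-of-variables instance of rule (2)
among representations of dimension `1` (`Budget.changeOfVariables_mem_relationsLE`).

The witness is the Möbius involution `φ = (αx + β)/(γx + δ)` of `GenusOneOneMove` with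
`u, v, w, z := e 0, e 1, e 2, e 3` (`α = uz − vw`, `β = vw(u+z) − uz(v+w)`, `γ = u+z−v−w`,
`δ = vw − uz`), which maps `O₁` onto `O₀`; its key identity `Q(φ x)(γx+δ)⁴ = det²·Q(x)` for the
monic `Q = ∏ᵢ (x − e i)` (`GenusOneOneMove.key_identity`) gives `q(φ x) = q(x)·φ'(x)²`
(`q = lc·Q`, `φ' = det/(γx+δ)²`), whence the rule-2 integrand identity
`c/√q(x) = (c/√q(φ x))·|φ'(x)|` exactly on `O₁`. Differences from the rational template
`GenusOneOneMove.of_sub_of_mem_changeOfVariablesRel`: the branch points are REAL ALGEBRAIC (roots of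
`q ∈ ℚ[X]`), so `α, …, δ` are real algebraic and `Φ(p) = (φ(p 0))` is `ℚ`-semialgebraic by
`isSemialgebraicFunOn_const_of_isAlgebraic` and the arithmetic of semialgebraic functions; and the
leading coefficient `lc` of `q` is carried along (`Engine.aeval_eq_leadingCoeff_mul_prod`: a real
quartic with the four distinct roots `e i` is `lc · ∏ᵢ (x − e i)`, by counting roots).

References: M. Kontsevich, D. Zagier, *Periods* (2001), §1.2 rule (2) [KontsevichZagier2001];
B. Gross, J. Harris, *Real algebraic curves*, Ann. Sci. ÉNS 14 (1981), §3 [GrossHarris1981];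
J. Bochnak, M. Coste, M.-F. Roy, *Real Algebraic Geometry* (1998), Prop. 2.2.6
[BochnakCosteRoy1998]. No definitions are introduced.
-/

noncomputable section

open Set MeasureTheory
open scoped Polynomial
open Literature.ModelTheory.ExponentialFields (IsSemialgebraic)
open Literature.NumberTheory.Transcendental Literature.NumberTheory.Transcendental.KZ
open Summit.KontsevichZagierPeriods.HermiteRigidity.GenusTwoCycleTransfer
  (det_smul_id_fin_one hasFDerivAt_fin_one)
open Summit.KontsevichZagierPeriods.AbelContraction.GenusOneOneMove
  (det_eq den_pos_left den_pos_right mobius_mem_left mobius_mem_right mobius_invol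
    mobius_injective hasDerivAt_mobius key_identity)

namespace Summit.KontsevichZagierPeriods.AbelContraction.RealHyperellipticSector

namespace Engine

/-- **A real M-quartic factors through its four real roots**: if `q ∈ ℚ[X]` has degree `4` and its
real roots are exactly `e 0 < e 1 < e 2 < e 3`, then
`q(t) = lc · (t − e 0)(t − e 1)(t − e 2)(t − e 3)` for every real `t` (`lc` the leading
coefficient): the four distinct roots exhaust the `≤ 4` roots of `q` over `ℝ`, counted with
multiplicity. [folklore] -/
theorem aeval_eq_leadingCoeff_mul_prod (q : ℚ[X]) (e : ℕ → ℝ) (hdeg : q.natDegree = 4)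
    (he : StrictMono e) (hroot : ∀ t : ℝ, Polynomial.aeval t q = 0 ↔ ∃ i < 4, t = e i) (t : ℝ) :
    Polynomial.aeval t q =
      (q.leadingCoeff : ℝ) * ((t - e 0) * (t - e 1) * ((t - e 2) * (t - e 3))) := by
  obtain ⟨qR, hqR⟩ : ∃ qR : ℝ[X], qR = q.map (algebraMap ℚ ℝ) := ⟨_, rfl⟩
  have hq0 : q ≠ 0 := by
    rintro rfl
    simp at hdeg
  have hqR0 : qR ≠ 0 := hqR ▸ Polynomial.map_ne_zero hq0
  have hdegR : qR.natDegree = 4 := by rw [hqR, Polynomial.natDegree_map, hdeg]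
  have hlc : qR.leadingCoeff = (q.leadingCoeff : ℝ) := by
    rw [hqR, Polynomial.leadingCoeff_map, eq_ratCast]
  have heval : ∀ s : ℝ, qR.eval s = Polynomial.aeval s q := fun s => by
    rw [hqR, Polynomial.eval_map_algebraMap]
  have hmem : ∀ i, i < 4 → e i ∈ qR.roots := fun i hi => by
    rw [Polynomial.mem_roots hqR0, Polynomial.IsRoot.def, heval]
    exact (hroot _).mpr ⟨i, hi, rfl⟩
  have hinj := he.injective
  -- the four roots exhaust the roots of `qR`
  have hSnd : ({e 0, e 1, e 2, e 3} : Multiset ℝ).Nodup := by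
    simp [hinj.eq_iff]
  have hScard : Multiset.card ({e 0, e 1, e 2, e 3} : Multiset ℝ) = 4 := by simp
  have hle : ({e 0, e 1, e 2, e 3} : Multiset ℝ) ≤ qR.roots := by
    refine (Multiset.le_iff_subset hSnd).mpr fun a ha => ?_
    simp only [Multiset.insert_eq_cons, Multiset.mem_cons, Multiset.mem_singleton] at ha
    rcases ha with rfl | rfl | rfl | rfl
    exacts [hmem 0 (by norm_num), hmem 1 (by norm_num), hmem 2 (by norm_num),
      hmem 3 (by norm_num)]
  have hcard : Multiset.card qR.roots = qR.natDegree := by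
    refine le_antisymm (Polynomial.card_roots' qR) ?_
    rw [hdegR, ← hScard]
    exact Multiset.card_le_card hle
  have hSeq : ({e 0, e 1, e 2, e 3} : Multiset ℝ) = qR.roots :=
    Multiset.eq_of_le_of_card_le hle (by rw [hcard, hdegR, hScard])
  have hprod := Polynomial.C_leadingCoeff_mul_prod_multiset_X_sub_C hcard
  rw [← hSeq, hlc] at hprod
  have h := congrArg (Polynomial.eval t) hprod
  rw [heval] at h
  rw [← h]
  simp only [Multiset.insert_eq_cons, Multiset.map_cons, Multiset.map_singleton,
    Multiset.prod_cons, Multiset.prod_singleton, Polynomial.eval_mul, Polynomial.eval_C,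
    Polynomial.eval_sub, Polynomial.eval_X]
  ring

/-- **The genus-one move with real algebraic branch points.** For reals `u < v < w < z`, all
algebraic over `ℚ`, a radicand `Q(t) = lc·(t−u)(t−v)(t−w)(t−z)` (any real `lc`) and a real
constant `c`, representations `r₀ = [(u,v), c/√Q]`, `r₁ = [(w,z), c/√Q]` (domains prescribed,
integrands prescribed on the domains) satisfy `[r₁] − [r₀] ∈ KZ.relationsLE 1`: one
change-of-variables instance in dimension `1` along the Möbius involution
`Φ(p) = (φ(p 0))`, `φ = (αx+β)/(γx+δ)` swapping `u ↔ z`, `v ↔ w`, with `Φ' p = φ'(p 0) • id`;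
`Φ` is `ℚ`-semialgebraic because `α, β, γ, δ ∈ ℤ[u,v,w,z]` are real algebraic, and the integrand
identity `c/√Q(x) = (c/√Q(φ x))·|φ'(x)|` on `(w, z)` is `Q(φ x) = Q(x)·φ'(x)²`
(`GenusOneOneMove.key_identity`). [cite: KontsevichZagier2001, §1.2 rule (2)] -/
theorem of_sub_of_mem_relationsLE {u v w z lc c : ℝ} (huv : u < v) (hvw : v < w) (hwz : w < z)
    (hu : IsAlgebraic ℚ u) (hv : IsAlgebraic ℚ v) (hw : IsAlgebraic ℚ w) (hz : IsAlgebraic ℚ z)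
    (Q : ℝ → ℝ) (hQ : ∀ t, Q t = lc * ((t - u) * (t - v) * ((t - w) * (t - z))))
    (r₀ r₁ : IntegralRep 1)
    (hd₀ : r₀.domain = {p | u < p 0 ∧ p 0 < v}) (hd₁ : r₁.domain = {p | w < p 0 ∧ p 0 < z})
    (hi₀ : EqOn r₀.integrand (fun p => c / Real.sqrt (Q (p 0))) r₀.domain)
    (hi₁ : EqOn r₁.integrand (fun p => c / Real.sqrt (Q (p 0))) r₁.domain) :
    of r₁ - of r₀ ∈ relationsLE 1 := by
  -- the Möbius data (real algebraic)
  set α : ℝ := u * z - v * w with hα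
  set β : ℝ := v * w * (u + z) - u * z * (v + w) with hβ
  set γ : ℝ := u + z - v - w with hγ
  set δ : ℝ := v * w - u * z with hδ
  have hαa : IsAlgebraic ℚ α := (hu.mul hz).sub (hv.mul hw)
  have hβa : IsAlgebraic ℚ β :=
    ((hv.mul hw).mul (hu.add hz)).sub ((hu.mul hz).mul (hv.add hw))
  have hγa : IsAlgebraic ℚ γ := ((hu.add hz).sub hv).sub hw
  have hδa : IsAlgebraic ℚ δ := (hv.mul hw).sub (hu.mul hz)
  have hdet : α * δ - β * γ ≠ 0 := by
    rw [det_eq hα hβ hγ hδ]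
    have h : 0 < (v - u) * (w - u) * (z - v) * (z - w) :=
      mul_pos (mul_pos (mul_pos (by linarith) (by linarith)) (by linarith)) (by linarith)
    linarith
  -- the denominator is positive on the source oval `(w, z)`
  have hD₁ : ∀ p ∈ r₁.domain, 0 < γ * p 0 + δ := fun p hp => by
    rw [hd₁] at hp
    exact den_pos_right hγ hδ huv hvw hp.1 hp.2
  -- the map and its derivative
  set Φ : (Fin 1 → ℝ) → (Fin 1 → ℝ) := fun p _ => (α * p 0 + β) / (γ * p 0 + δ) with hΦ_def
  set Φ' : (Fin 1 → ℝ) → ((Fin 1 → ℝ) →L[ℝ] (Fin 1 → ℝ)) :=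
    fun p => ((α * δ - β * γ) / (γ * p 0 + δ) ^ 2) • ContinuousLinearMap.id ℝ (Fin 1 → ℝ)
    with hΦ'_def
  have hdet' : ∀ p, (Φ' p).det = (α * δ - β * γ) / (γ * p 0 + δ) ^ 2 := fun p =>
    det_smul_id_fin_one _
  -- the image of the source oval is the target oval
  have himg : r₀.domain = Φ '' r₁.domain := by
    rw [hd₀, hd₁]
    ext q
    simp only [mem_image, mem_setOf_eq]
    constructor
    · rintro ⟨hq1, hq2⟩
      have hy := mobius_mem_right hα hβ hγ hδ hvw hwz hq1 hq2
      refine ⟨fun _ => (α * q 0 + β) / (γ * q 0 + δ), hy, ?_⟩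
      funext i
      rw [Fin.fin_one_eq_zero i]
      exact mobius_invol (by rw [hα, hδ]; ring) (den_pos_left hγ hδ hvw hwz hq1 hq2).ne'
        (den_pos_right hγ hδ huv hvw hy.1 hy.2).ne'
    · rintro ⟨p, ⟨hp1, hp2⟩, rfl⟩
      exact mobius_mem_left hα hβ hγ hδ huv hvw hp1 hp2
  refine Budget.changeOfVariables_mem_relationsLE le_rfl Φ Φ' ?_ ?_ ?_ himg ?_
  · -- `Φ` is `ℚ`-semialgebraic: a Möbius map with real algebraic coefficients
    have hσ := r₁.isSemialgebraic_domain
    refine IsSemialgebraicMapOn.of_forall hσ fun _ => ?_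
    have hx0 : IsSemialgebraicFunOn ℚ r₁.domain (fun p : Fin 1 → ℝ => p 0) := by
      simpa using isSemialgebraicFunOn_aeval hσ (MvPolynomial.X 0 : MvPolynomial (Fin 1) ℚ)
    have hN : IsSemialgebraicFunOn ℚ r₁.domain (fun p : Fin 1 → ℝ => α * p 0 + β) :=
      ((isSemialgebraicFunOn_const_of_isAlgebraic hσ hαa).fun_mul hx0).fun_add
        (isSemialgebraicFunOn_const_of_isAlgebraic hσ hβa)
    have hD : IsSemialgebraicFunOn ℚ r₁.domain (fun p : Fin 1 → ℝ => γ * p 0 + δ) :=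
      ((isSemialgebraicFunOn_const_of_isAlgebraic hσ hγa).fun_mul hx0).fun_add
        (isSemialgebraicFunOn_const_of_isAlgebraic hσ hδa)
    exact hN.div hD fun p hp => (hD₁ p hp).ne'
  · -- derivative within the oval
    intro p hp
    exact (hasFDerivAt_fin_one (fun y => (α * y + β) / (γ * y + δ)) _ p
      (hasDerivAt_mobius α β γ δ (p 0) (hD₁ p hp).ne')).hasFDerivWithinAt
  · -- injectivity (`det ≠ 0`)
    intro p hp q hq h
    have h' : (α * p 0 + β) / (γ * p 0 + δ) = (α * q 0 + β) / (γ * q 0 + δ) := congrFun h 0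
    have hpq : p 0 = q 0 := mobius_injective hdet (hD₁ p hp).ne' (hD₁ q hq).ne' h'
    funext i
    rw [Fin.fin_one_eq_zero i]
    exact hpq
  · -- the Jacobian identity `c/√Q(x) = (c/√Q(φ x))·|φ'(x)|`, exactly on the oval
    intro p hp
    have hmem : Φ p ∈ r₀.domain := himg ▸ mem_image_of_mem Φ hp
    have hDp := (hD₁ p hp).ne'
    have hk : (α * δ - β * γ) / (γ * p 0 + δ) ^ 2 ≠ 0 := div_ne_zero hdet (pow_ne_zero 2 hDp)
    have hQφ : Q ((α * p 0 + β) / (γ * p 0 + δ)) =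
        Q (p 0) * ((α * δ - β * γ) / (γ * p 0 + δ) ^ 2) ^ 2 := by
      rw [hQ, hQ]
      linear_combination (-lc) * key_identity hα hβ hγ hδ hDp
    rw [hi₁ hp, hi₀ hmem, hdet' p]
    show c / Real.sqrt (Q (p 0)) = c / Real.sqrt (Q ((α * p 0 + β) / (γ * p 0 + δ))) *
      |(α * δ - β * γ) / (γ * p 0 + δ) ^ 2|
    rw [hQφ, Real.sqrt_mul' _ (sq_nonneg _), Real.sqrt_sq_eq_abs, div_mul_eq_mul_div,
      mul_div_mul_right _ _ (abs_ne_zero.mpr hk)]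

end Engine

/-- **The genus-one rung of the engine** (registered sub-goal `cauchyRel_genus_one` of the stub
`stub_engine`, crux stmt-KontsevichZagierPeriods-12475): for an M-quartic `q ∈ ℚ[X]` (degree `4`,
negative leading coefficient, real roots exactly `e 0 < e 1 < e 2 < e 3`), a constant `P`
(`deg P < 1`) and representations `r j = [O_j, P/√q]` over the ovals `O_j = (e (2j), e (2j+1))`,
the real Cauchy relator `Σ_{j<2} (−1)^j [r j] = [r 0] − [r 1]` lies in `KZ.relationsLE 1`: it is
minus the change-of-variables instance `[r 1] − [r 0]` of `Engine.of_sub_of_mem_relationsLE`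
along the Möbius involution swapping `e 0 ↔ e 3`, `e 1 ↔ e 2` (the roots `e i` are real algebraic,
`q = lc · ∏ᵢ (x − e i)` over `ℝ` by `Engine.aeval_eq_leadingCoeff_mul_prod`, `P = C a`).
[cite: KontsevichZagier2001, §1.2 rule (2)] [cite: GrossHarris1981, Prop. 3.2] -/
theorem cauchyRel_genus_one : ∀ (q : Polynomial ℚ) (e : ℕ → ℝ) (P : Polynomial ℚ)
    (r : Fin 2 → KZ.IntegralRep 1), q.natDegree = 4 → q.leadingCoeff < 0 → StrictMono e →
    (∀ t : ℝ, Polynomial.aeval t q = 0 ↔ ∃ i < 4, t = e i) → P.natDegree < 1 →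
    (∀ j, (r j).domain = {p | e (2 * (j : ℕ)) < p 0 ∧ p 0 < e (2 * (j : ℕ) + 1)}) →
    (∀ j, Set.EqOn (r j).integrand
      (fun p => Polynomial.aeval (p 0) P / Real.sqrt (Polynomial.aeval (p 0) q)) (r j).domain) →
    ∑ j : Fin 2, ((-1 : ℤ) ^ (j : ℕ)) • KZ.of (r j) ∈ KZ.relationsLE 1 := by
  intro q e P r hdeg _hlc he hroot hP hdom hint
  -- `P` is a constant `a`
  obtain ⟨a, rfl⟩ := Polynomial.natDegree_eq_zero.mp (Nat.lt_one_iff.mp hP)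
  -- the two ovals and the two integrands
  have hd₀ := hdom 0
  have hd₁ := hdom 1
  have hi₀ := hint 0
  have hi₁ := hint 1
  simp only [Fin.val_zero, mul_zero, zero_add] at hd₀
  simp only [Fin.val_one, mul_one, Nat.reduceAdd] at hd₁
  simp only [Polynomial.aeval_C, eq_ratCast] at hi₀ hi₁
  -- the roots are real algebraic
  have hq0 : q ≠ 0 := by
    rintro rfl
    simp at hdeg
  have halg : ∀ i, i < 4 → IsAlgebraic ℚ (e i) := fun i hi =>
    ⟨q, hq0, (hroot _).mpr ⟨i, hi, rfl⟩⟩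
  -- the move `[r 1] − [r 0]`
  have h10 := Engine.of_sub_of_mem_relationsLE (he (by norm_num : (0 : ℕ) < 1))
    (he (by norm_num : (1 : ℕ) < 2)) (he (by norm_num : (2 : ℕ) < 3))
    (halg 0 (by norm_num)) (halg 1 (by norm_num)) (halg 2 (by norm_num)) (halg 3 (by norm_num))
    (fun t => Polynomial.aeval t q) (Engine.aeval_eq_leadingCoeff_mul_prod q e hdeg he hroot)
    (r 0) (r 1) hd₀ hd₁ hi₀ hi₁
  rw [Fin.sum_univ_two]
  simp only [Fin.val_zero, Fin.val_one, pow_zero, pow_one, one_zsmul, neg_one_zsmul]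
  have e' : KZ.of (r 0) + -KZ.of (r 1) = -(KZ.of (r 1) - KZ.of (r 0)) := by abel
  rw [e']
  exact neg_mem h10

/-- **The engine for quartics** (corollary of the rung `cauchyRel_genus_one`): for `q ∈ ℚ[X]` of
degree `4` every real Cauchy relator of `cauchyRel q` lies in `KZ.relationsLE 1` — the degree
`2g + 2 = 4` forces genus `g = 1`, where the relator `Σ_{j<2} (−1)^j [O_j, P/√q]` is the genus-one
rung. [cite: KontsevichZagier2001, §1.2 rule (2)] [cite: GrossHarris1981, Prop. 3.2] -/
theorem cauchyRel_subset_of_natDegree_eq_four : ∀ (q : Polynomial ℚ), q.natDegree = 4 →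
    cauchyRel q ⊆ (KZ.relationsLE 1 : Set KZ.FormalRep) := by
  intro q hdeg x hx
  obtain ⟨g, e, P, r, hdeg', hlc, he, hroot, hP, hdom, hint, rfl⟩ := hx
  obtain rfl : g = 1 := by omega
  exact cauchyRel_genus_one q e P r hdeg hlc he hroot hP hdom hint

end Summit.KontsevichZagierPeriods.AbelContraction.RealHyperellipticSector

end
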